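import Literature.MathematicalPhysics.QuantumFieldTheory.Balaban1983to89.TreeLengthTorus
import Literature.Computability.AlgebraicComplexity.SlidingWindowNumerics

/-!
# Dimock, *The renormalization group according to Balaban* II, App. D "connected polymer sums": LEMMA D.1 (lugnut1)
and LEMMA D.2 (lugnut2) — the ANCHORED SUPERSET SUM — PROVED for an arbitrary cell adjacency of bounded degree, with
the Remark (999), and instantiated on the cell's periodic polymer model

**Citation header (reproduction of PUBLISHED work; template of the Balaban lattice Yang–Mills cell).**
J. Dimock, *The renormalization group according to Balaban. II. Large fields*, J. Math. Phys. **54** (2013) 092301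
(= arXiv:1212.5562v2) [Dimock2013BalabanII]: Appendix D `\section{connected polymer sums} \label{sanibel}` (TeX
L6692–6769): Lemma D.1 `\label{donut1}` = eq. (lugnut1) (L6699–6704) with its proof (L6708–6722), Lemma D.2
`\label{donut2}` = eq. (lugnut2) (L6727–6732) with its proof (L6736–6759), and the Remark = eq. (999) (L6763–6769);
§3.1 eq. (lugnut8) (L1707–1717, the statement of D.1 in the text) and the uses of D.2 in §3.13 "localization"
(L4705, L5324) and §3.18 "final localization" (L6339); arXiv subsection numbering (cell TEMPLATE.md CHANGES v2 (b)).  TeX line numbers refer to the arXiv source held by the cell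
(`inputs/files/dimock/src/1212.5562/1212.5562.tex`, 7217 lines, sha256[:16] 75c5792fc48eacbc).

**What the paper prints (verbatim).**  L6694–6696: *"Let X ∈ 𝒟_{k,Ω} be a multiscale polymer, and let |X|_Ω be
the number of elementary cubes in X as in section* [§3.1.2 «polymers», `\ref{polymersection}` = TeX L1676] *, except now
we work in arbitrary dimension d."*
**Lemma D.1** (L6699–6704): *"For κ_* sufficiently large (κ_* ≥ 𝒪(log L)) and any elementary cube in □ ⊂ 𝒟_{k,Ω}
Σ_{X ∈ 𝒟_{k,Ω}, X ⊃ □} e^{−κ_*|X|_Ω} ≤ e^{−½κ_*}"*; PROOF (L6708–6722): *"Σ_{X ⊃ □} e^{−κ_*|X|_Ω} ≤ Σ_{n ≥ 1}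
e^{−κ_* n} |{X ⊃ □ : |X|_Ω = n}|.  To count |{X ⊃ □ : |X|_Ω = n}| note that for each such X there is a tree (not
unique) whose lines are pairs of adjacent cubes in X. This tree will have n−1 lines. Distinct polymers give distinct
trees so that number is less than the number of such trees. Each tree can be traversed with a path starting at □ and
traversing each line exactly twice. Thus the number of trees in less than the number of paths of length 2n starting
at □. Since each cube has at most 2dL^{d−1} neighbors this is bounded by (2dL^{d−1})^{2n}. Thus the sum is bounded by
Σ_{n≥1} e^{−κ_* n}(2dL^{d−1})^{2n} ≤ Σ_{n≥1} e^{−(κ_* − 2 log(2dL^{d−1}))n} ≤ e^{−½κ_*} provided ½κ_* ≥ 2 log(2dL^{d−1})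
+ log 2."*  L6725: *"For the next result we relax the condition that X be connected, so X is just a union of
elementary cubes … We sum over Y ⊃ X of the same form. A connected component of Y has the property that every
connected component of X is either contained in it or is disjoint from it."*  **Lemma D.2** (L6727–6732): *"With κ_*
as above  Σ′_{Y ⊃ X} e^{−κ_*|Y−X|_Ω} ≤ exp(e^{−½κ_*}(2dL^{d−1}+1)|X|_Ω)  where the primed sum means every connected
component of Y contains at least one connected component of X"*; PROOF (L6736–6759): *"Let {W_α} be the connected
components of Y−X. Let X′ be the enlargement of X formed by adding all cubes which have a face in common with X. Then
each W_α contains some cube in X′ − X, (If not W_α is disjoint from X. Then W_α is a connected subset of Y with no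
path in Y to any other cube in Y, since any such path would have to pass through X. Hence W_α is a connected
component of Y which contains no connected component of X which is a contradiction.) … The upshot is that the sum
can be written as a sum over the {W_α}.  We enlarge the sum to a sum over collections {□_α} of disjoint cubes in
X′−X or even X′, and connected W_α so W_α ⊃ □_α. Using also the previous lemma the sum is dominated by Σ_{{□_α}}
Σ_{{W_α : W_α ⊃ □_α}} e^{−κ_* Σ_α|W_α|_Ω} = Σ_{{□_α}} Π_α Σ_{W ⊃ □_α} e^{−κ_*|W|_Ω} ≤ Σ_{{□_α}} Π_α e^{−½κ_*} =
(1 + e^{−½κ_*})^{|X′|_Ω} ≤ exp(e^{−½κ_*}|X′|_Ω).  Since |X′|_Ω ≤ (2dL^{d−1}+1)|X|_Ω we have the result."*  **Remark**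
(L6763–6769): *"A variation is the following. Suppose X ∈ 𝒟_k(mod Ω_k), so X is connected and either contains a
connected component of Ω_k^c or is disjoint from it. Then X′−X ⊂ Ω_k so the anchors {□_α} in X′−X are M-cubes. Hence
we get |X−X′|_M* ⟦sic: `|X′−X|_M`⟧ *≤ |X′|_M rather than the (possibly much larger) |X′|_Ω. The result is (999) Σ_{Y ∈ 𝒟_{k,Ω} :
Y ⊃ X} e^{−κ_*|Y−X|_Ω} ≤ exp(e^{−½κ_*}(2dL^{d−1}+1)|X|_M)"*.

**What is reproduced here (kernel-checked, zero `sorry`).**  Both lemmas are statements about an arbitrary finite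
"cube" set `V` with a symmetric adjacency `R` ("have a face in common"), neighbour lists `nbr` and a degree bound
`#(nbr x) ≤ Δ` (Dimock: `Δ = 2dL^{d−1}` for the multiscale cubes of `𝒟_{k,Ω}`, `Δ = 2d` for the `M`-cubes of `𝒟_k`),
weighted by the NUMBER of cubes — exactly the setting of the tree's `Literature.Probability.LatticeModels.PolymerGasGeometric`
(`IsRConnected`, `rcomponent`/`rcomponents` = the connected components {W_α}, `sum_pow_card_le_of_connected` = D.1's
tree/path count in lazy-walk form, from `…LatticeAnimals.card_connectedFamily_le`).  In that setting this module PROVES: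
Part 1 — the primed condition `Anchored R X Y` (*"every connected component of Y contains at least one connected
component of X"*, stated as: every cube of `Y ⊇ X` is joined to `X` by a chain of adjacent cubes of `Y`; the
equivalence with the printed wording is `anchored_iff_rcomponents`), the exterior layer `X′ − X` (`extBdry`, with
`#(X′−X) ≤ Δ·#X`), and the FIRST HALF of D.2's proof: every component `W_α` of `Y − X` contains an anchor in `X′ − X`
(`hasAnchors_extBdry` — the parenthetical argument of L6738–6740, as a first-exit induction along the chain);
Part 2 — the SECOND HALF: listing each `W_α` at ONE chosen anchor (`pick`, `compAt`, `listing`) is injective in `Y`,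
partitions `Y − X` (`biUnion_compAt`, `pairwiseDisjoint_compAt`, `card_sdiff_eq_sum`), so that the primed sum is
dominated by the product over anchors of `1 + Σ_{W ∋ □} λ^{|W|}` (`sum_pow_card_sdiff_le`: **Σ′_{Y ⊇ X} λ^{|Y−X|} ≤
(1 + 2λ)^{#A}** for every anchor set `A` met by all the `W_α`, `0 ≤ λ`, `(Δ+1)²λ ≤ ½`) — the Remark (999) is this
statement read with a smaller anchor set; Part 3 — LEMMA D.1 and LEMMA D.2 in the printed exponential form under the
printed parameter clause *"½κ_* ≥ 2 log(2dL^{d−1}) + log 2"* (here `½κ ≥ 2 log(Δ+1) + log 2`): `donut1`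
(**Σ_{X ∋ □} e^{−κ|X|} ≤ e^{−½κ}**) and `donut2` (**Σ′_{Y ⊇ X} e^{−κ|Y−X|} ≤ exp(e^{−½κ}(Δ+1)|X|)**), with the sharper
anchor form `donut2_anchors` (**≤ exp(e^{−½κ} #A)**, = (999)) and the case Dimock actually uses at L4705 *"(here Y, Y₂
are connected …)"*: for connected `Y ⊇ X ≠ ∅` the primed condition is automatic (`anchored_of_isRConnected`);
Part 4 — the instantiation on the cell's PERIODIC polymer model (unit pv22's `…Balaban1983to89.TreeLengthTorus`: cubes
`TPt d N = (ℤ/N)^d`, common-wall adjacency `TAdj`, `tnbr`, degree `≤ 2d` by `tdegreeLE`, localization domains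
`TFaceConnected`), every dimension `d`: `donut1_torus`, `donut2_torus`, `donut2_torus_connected` with `Δ = 2d`.

**Divergence from the printed constants (declared).**  (i) The count of Part 3 is the tree's LAZY-walk count
`(Δ+1)^{2n}` (`card_connectedFamily_le`) instead of Dimock's `Δ^{2n}`, so the parameter clause reads `½κ ≥ 2 log(Δ+1)
+ log 2` for his `½κ_* ≥ 2 log Δ + log 2` (Δ = 2dL^{d−1}); harmless — Dimock only uses *"κ_* ≥ 𝒪(log L)"*.  (ii) The
anchors are taken in `X′ − X` (Dimock: *"in X′−X or even X′"*), which gives the exponent `Δ·|X|`; the printed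
`(2dL^{d−1}+1)|X| = (Δ+1)|X|` is recovered by monotonicity and is the form stated in `donut2`.  (iii) The MULTISCALE
carrier `𝒟_{k,Ω}` itself (cubes of edge `L^{−(k−j)}M` in `δΩ_j`, adjacency across scales, `Δ = 2dL^{d−1}`, the count
`|·|_Ω`) is NOT constructed here: Parts 1–3 hold verbatim for it once it is presented as a triple `(V, R, nbr)` with
`#(nbr x) ≤ 2dL^{d−1}`; Part 4 instantiates the single-scale case `𝒟_k` (all cubes `M`-cubes, `Δ = 2d`), which is the
case of (999)'s anchors and of L4705 (`LM`-cubes).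

**What is NOT claimed.**  Nothing about [Dimock2013BalabanII] beyond App. D (the uses at L4705/L5324/L6339 combine D.2
with (snow), (ninety) and the tree-length bounds, kernel elsewhere in this directory: `HoleSummability`,
`ThreeSortedResummation`, `Reblocking`); nothing about any Bałaban paper — the B-side by-reference combinatorics
([Balaban1987RG1] (0.26)/(0.30), [Balaban1988RG2Cluster] (2.27)–(2.36), B14 (2.45)–(2.48), B16 (1.92)–(1.95); cell
TEMPLATE.md §15.1, GAPS T-G9) are different statements with their own kernel modules.  Dimock's papers are published
and refereed and are the cell's TEMPLATE, not manuscripts under audit.  Value = kernel closure of the two remaining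
PROVED-in-print entries of TEMPLATE.md §15.1 row G5 (D.1 multiscale/anchored forms) over an arbitrary bounded-degree
cell complex and over the cell's own polymer model, NOT summit progress (YM₄ on T⁴ / infinite volume / mass gap are
elsewhere and out of scope).

Cell records: TEMPLATE.md §15.1 G5 / §15.2; unit `b2b-balaban-template` gen 26, journal claim D2-APPD-KERNEL.  NEW leaf;
imports `…Balaban1983to89.TreeLengthTorus` (unit pv22) — through it `Literature.Probability.LatticeModels.PolymerGasGeometric` —
and the tree's `Literature.Computability.AlgebraicComplexity.SlidingWindowNumerics` for the elementary step `(1+u)^k ≤ e^{uk}`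
(`SlidingWindow.one_add_pow_le_exp`, reused by name at the gate's request instead of re-proved: it is D.2's step *"(1 +
e^{−½κ_*})^{|X′|_Ω} ≤ exp(e^{−½κ_*}|X′|_Ω)"*, TeX L6754–6755); modifies nothing.  v1 = p192356; v1.1 = p192382 (docstring-only:
arXiv subsection numerals, the [§3.1.2] locator); v1.2 (docstring-only): fold of the cross-read GAPS.md C-adv9-118 (ok — objections
0; DOCFIX-1 LOW: `donut1`'s [cite] now also names §3.1 (lugnut8) L1707–1717 whose wording it quotes; INFO I1: the print's
«|X−X′|_M» at TeX L6766 is marked ⟦sic⟧ — `|X′−X|_M` is meant, and is what the Lean statements use).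
-/

noncomputable section

open Real Finset
open Literature.Probability.LatticeModels
open Literature.Computability.AlgebraicComplexity.SlidingWindow (one_add_pow_le_exp)
open Literature.MathematicalPhysics.QuantumFieldTheory.Balaban1983to89.TreeLengthTorus
  (TPt TAdj TStepIn TLinked TFaceConnected tnbr mem_tnbr tdegreeLE isRConnected_of_tFaceConnected)

namespace Literature.MathematicalPhysics.QuantumFieldTheory.Dimock2011to13.ConnectedPolymerSums

variable {V : Type*} [DecidableEq V]

/-! ## Part 1. Chains of adjacent cubes inside a cube set; the primed condition; the layer `X′ − X`; anchors -/

section Abstract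

variable {R : V → V → Prop}

/-- One step of a chain of adjacent cubes INSIDE the cube set `Q` (both ends in `Q`) — the step relation of the tree's
`Literature.Probability.LatticeModels.rcomponent` / `IsRConnected`, named. [folklore] -/
abbrev InStep (R : V → V → Prop) (Q : Finset V) : V → V → Prop := fun x y => R x y ∧ x ∈ Q ∧ y ∈ Q

/-- THE PRIMED CONDITION of Lemma D.2 for `Y ⊇ X` — [Dimock2013BalabanII] App. D, verbatim: *"the primed sum means
every connected component of Y contains at least one connected component of X"* — typed as: `X ⊆ Y` and every cube
of `Y` is joined to a cube of `X` by a chain of adjacent cubes of `Y` (equivalent to the printed wording: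
`anchored_iff_rcomponents`). [cite: Dimock2013BalabanII, App. D Lemma D.2 (arXiv:1212.5562v2 TeX L6727–6732)] -/
def Anchored (R : V → V → Prop) (X Y : Finset V) : Prop :=
  X ⊆ Y ∧ ∀ y ∈ Y, ∃ x ∈ X, Relation.ReflTransGen (InStep R Y) y x

/-- The primed condition IS the printed wording: for `X ⊆ Y`, every cube of `Y` is chained to `X` inside `Y` iff every
connected component of `Y` (the tree's `rcomponents R Y`) contains a connected component of `X`.
[cite: Dimock2013BalabanII, App. D Lemma D.2 (arXiv:1212.5562v2 TeX L6731)] -/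
theorem anchored_iff_rcomponents {X Y : Finset V} (hXY : X ⊆ Y) :
    Anchored R X Y ↔ ∀ C ∈ rcomponents R Y, ∃ C' ∈ rcomponents R X, C' ⊆ C := by
  constructor
  · intro hA C hC
    obtain ⟨p, hp, rfl⟩ := mem_rcomponents_iff.1 hC
    obtain ⟨x, hx, hpx⟩ := hA.2 p hp
    refine ⟨rcomponent R X x, mem_rcomponents_iff.2 ⟨x, hx, rfl⟩, ?_⟩
    intro z hz
    obtain ⟨hzX, hxz⟩ := mem_rcomponent.1 hz
    refine mem_rcomponent.2 ⟨hXY hzX, hpx.trans ?_⟩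
    exact Relation.ReflTransGen.mono (fun u v (h : R u v ∧ u ∈ X ∧ v ∈ X) =>
      (⟨h.1, hXY h.2.1, hXY h.2.2⟩ : R u v ∧ u ∈ Y ∧ v ∈ Y)) _ _ hxz
  · intro h
    refine ⟨hXY, fun y hy => ?_⟩
    obtain ⟨C', hC', hC'C⟩ := h _ (mem_rcomponents_iff.2 ⟨y, hy, rfl⟩)
    obtain ⟨x, hx, rfl⟩ := mem_rcomponents_iff.1 hC'
    have hxC : x ∈ rcomponent R Y y := hC'C (mem_rcomponent_self hx)
    have hreach := (mem_rcomponent.1 hxC).2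
    exact ⟨x, hx, hreach⟩

omit [DecidableEq V] in
/-- The case used at [Dimock2013BalabanII] §3.13 L4705 *"(here Y, Y₂ are connected and we use LM cubes)"*: if `Y ⊇ X`
is itself connected and `X` is non-empty, the primed condition holds. [cite: Dimock2013BalabanII, §3.13 (arXiv:1212.5562v2 TeX L4703–4705)] -/
theorem anchored_of_isRConnected {X Y : Finset V} (hXY : X ⊆ Y) (hX : X.Nonempty) (hY : IsRConnected R Y) :
    Anchored R X Y := by
  obtain ⟨x, hx⟩ := hX
  exact ⟨hXY, fun y hy => ⟨x, hx, hY.2 y hy x (hXY hx)⟩⟩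

/-- `X′ − X` — [Dimock2013BalabanII] App. D, verbatim: *"Let X′ be the enlargement of X formed by adding all cubes
which have a face in common with X"*; here: the neighbours of the cubes of `X` that are not in `X`.
[cite: Dimock2013BalabanII, App. D proof of Lemma D.2 (arXiv:1212.5562v2 TeX L6736–6737)] -/
def extBdry (nbr : V → Finset V) (X : Finset V) : Finset V := (X.biUnion nbr) \ X

/-- Membership in `X′ − X`. [folklore] -/
theorem mem_extBdry {nbr : V → Finset V} {X : Finset V} {a : V} :
    a ∈ extBdry nbr X ↔ (∃ x ∈ X, a ∈ nbr x) ∧ a ∉ X := by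
  simp [extBdry, mem_sdiff, mem_biUnion]

/-- *"Since |X′|_Ω ≤ (2dL^{d−1}+1)|X|_Ω"* — the layer count: `#(X′ − X) ≤ Δ·#X` when every cube has at most `Δ`
neighbours. [cite: Dimock2013BalabanII, App. D proof of Lemma D.2 (arXiv:1212.5562v2 TeX L6759)] -/
theorem card_extBdry_le {nbr : V → Finset V} {Δ : ℕ} (hΔ : ∀ x, (nbr x).card ≤ Δ) (X : Finset V) :
    (extBdry nbr X).card ≤ Δ * X.card := by
  calc (extBdry nbr X).card ≤ (X.biUnion nbr).card := card_le_card sdiff_subset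
    _ ≤ ∑ x ∈ X, (nbr x).card := card_biUnion_le
    _ ≤ ∑ _x ∈ X, Δ := sum_le_sum fun x _ => hΔ x
    _ = Δ * X.card := by rw [sum_const, smul_eq_mul, mul_comm]

/-- *"|X′|_Ω ≤ (2dL^{d−1}+1)|X|_Ω"* for `X′ = X ∪ (X′ − X)` itself: `#X′ ≤ (Δ+1)·#X`.
[cite: Dimock2013BalabanII, App. D proof of Lemma D.2 (arXiv:1212.5562v2 TeX L6759)] -/
theorem card_union_extBdry_le {nbr : V → Finset V} {Δ : ℕ} (hΔ : ∀ x, (nbr x).card ≤ Δ) (X : Finset V) :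
    (X ∪ extBdry nbr X).card ≤ (Δ + 1) * X.card := by
  calc (X ∪ extBdry nbr X).card ≤ X.card + (extBdry nbr X).card := card_union_le _ _
    _ ≤ X.card + Δ * X.card := by have := card_extBdry_le hΔ X; omega
    _ = (Δ + 1) * X.card := by ring

/-- ANCHOR SETS: `A` is met by every connected component `W_α` of `Y − X` (the components being the tree's
`rcomponent R (Y \ X) p`, `p ∈ Y − X`). [cite: Dimock2013BalabanII, App. D proof of Lemma D.2 (arXiv:1212.5562v2 TeX L6736–6737)] -/
def HasAnchors (R : V → V → Prop) (A X Y : Finset V) : Prop :=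
  ∀ p ∈ Y \ X, ∃ a ∈ rcomponent R (Y \ X) p, a ∈ A

/-- A larger set is still an anchor set (*"disjoint cubes in X′−X or even X′"*). [folklore] -/
theorem HasAnchors.mono {A A' X Y : Finset V} (h : HasAnchors R A X Y) (hAA' : A ⊆ A') : HasAnchors R A' X Y :=
  fun p hp => by obtain ⟨a, ha, haA⟩ := h p hp; exact ⟨a, ha, hAA' haA⟩

/-- **FIRST HALF OF THE PROOF OF LEMMA D.2** — [Dimock2013BalabanII] App. D, verbatim: *"Let {W_α} be the connected
components of Y−X. … Then each W_α contains some cube in X′ − X, (If not W_α is disjoint from X. Then W_α is a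
connected subset of Y with no path in Y to any other cube in Y, since any such path would have to pass through X.
Hence W_α is a connected component of Y which contains no connected component of X which is a contradiction.)"* —
PROVED as a first-exit argument: follow a chain in `Y` from `p ∈ W_α` to `X`; the cube before its first cube in `X`
lies in `W_α ∩ (X′ − X)`. [cite: Dimock2013BalabanII, App. D proof of Lemma D.2 (arXiv:1212.5562v2 TeX L6736–6740)] -/
theorem hasAnchors_extBdry (hR : ∀ x y, R x y → R y x) {nbr : V → Finset V}
    (hnbr : ∀ x y, R x y → y ∈ nbr x) {X Y : Finset V} (hA : Anchored R X Y) :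
    HasAnchors R (extBdry nbr X) X Y := by
  intro p hp
  rw [mem_sdiff] at hp
  obtain ⟨x, hx, hpx⟩ := hA.2 p hp.1
  -- walk along the chain from `p` to `x ∈ X` inside `Y` until the first cube of `X`
  have key : ∀ q, Relation.ReflTransGen (InStep R Y) q x → q ∈ Y → q ∉ X →
      ∃ a b, Relation.ReflTransGen (InStep R (Y \ X)) q a ∧ a ∈ Y \ X ∧ R a b ∧ b ∈ X := by
    intro q hqx
    induction hqx using Relation.ReflTransGen.head_induction_on with
    | refl => intro _ hxX; exact absurd hx hxX
    | @head q c hqc hcx ih =>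
      intro hqY hqX
      by_cases hcX : c ∈ X
      · exact ⟨q, c, Relation.ReflTransGen.refl, mem_sdiff.2 ⟨hqY, hqX⟩, hqc.1, hcX⟩
      · obtain ⟨a, b, hca, ha, hab, hb⟩ := ih hqc.2.2 hcX
        exact ⟨a, b, Relation.ReflTransGen.head ⟨hqc.1, mem_sdiff.2 ⟨hqY, hqX⟩, mem_sdiff.2 ⟨hqc.2.2, hcX⟩⟩ hca,
          ha, hab, hb⟩
  obtain ⟨a, b, hpa, ha, hab, hb⟩ := key p hpx hp.1 hp.2
  refine ⟨a, mem_rcomponent.2 ⟨ha, hpa⟩, ?_⟩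
  rw [mem_extBdry]
  exact ⟨⟨b, hb, hnbr b a (hR a b hab)⟩, (mem_sdiff.1 ha).2⟩

/-- With anchors *"or even X′"*: `X ∪ (X′ − X)` is an anchor set under the primed condition. [cite: Dimock2013BalabanII, App. D proof of Lemma D.2 (arXiv:1212.5562v2 TeX L6748)] -/
theorem hasAnchors_union_extBdry (hR : ∀ x y, R x y → R y x) {nbr : V → Finset V}
    (hnbr : ∀ x y, R x y → y ∈ nbr x) {X Y : Finset V} (hA : Anchored R X Y) :
    HasAnchors R (X ∪ extBdry nbr X) X Y :=
  (hasAnchors_extBdry hR hnbr hA).mono subset_union_right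

/-! ## Part 2. Listing the components `W_α` of `Y − X` at one chosen anchor each: a partition of `Y − X`, injective in `Y` -/

/-- One CHOSEN anchor of the cube set `C` in `A`, as a sub-singleton (`∅` if `C` misses `A`) — the choice *"connected
W_α so W_α ⊃ □_α"* of one cube `□_α` per component. [cite: Dimock2013BalabanII, App. D proof of Lemma D.2 (arXiv:1212.5562v2 TeX L6748)] -/
def pick (A C : Finset V) : Finset V :=
  if h : (C ∩ A).Nonempty then {Classical.choose h} else ∅

/-- The chosen anchor lies in `C ∩ A`. [folklore] -/
theorem pick_subset (A C : Finset V) : pick A C ⊆ C ∩ A := by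
  unfold pick
  split_ifs with h
  · exact singleton_subset_iff.2 (Classical.choose_spec h)
  · exact empty_subset _

/-- A set meeting `A` has a chosen anchor. [folklore] -/
theorem pick_nonempty {A C : Finset V} (h : (C ∩ A).Nonempty) : (pick A C).Nonempty := by
  unfold pick
  rw [dif_pos h]
  exact singleton_nonempty _

/-- At most one chosen anchor. [folklore] -/
theorem eq_of_mem_pick {A C : Finset V} {a a' : V} (ha : a ∈ pick A C) (ha' : a' ∈ pick A C) : a = a' := by
  unfold pick at ha ha'
  split_ifs at ha ha' with h
  · rw [mem_singleton] at ha ha'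
    rw [ha, ha']
  · simp at ha

/-- `W_α` LISTED AT ITS CHOSEN ANCHOR: the component of `Y − X` through `a` if `a` is that component's chosen anchor,
`∅` otherwise. [cite: Dimock2013BalabanII, App. D proof of Lemma D.2 (arXiv:1212.5562v2 TeX L6744–6748)] -/
def compAt (R : V → V → Prop) (A X Y : Finset V) (a : V) : Finset V :=
  if a ∈ pick A (rcomponent R (Y \ X) a) then rcomponent R (Y \ X) a else ∅

/-- Listed sets lie in `Y − X`. [folklore] -/
theorem compAt_subset {A X Y : Finset V} (a : V) : compAt R A X Y a ⊆ Y \ X := by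
  unfold compAt
  split_ifs
  · exact rcomponent_subset _ _
  · exact empty_subset _

/-- A non-empty listed set IS the component through its index, and the index is its chosen anchor. [folklore] -/
theorem compAt_eq_of_mem {A X Y : Finset V} {a z : V} (hz : z ∈ compAt R A X Y a) :
    compAt R A X Y a = rcomponent R (Y \ X) a ∧ a ∈ pick A (rcomponent R (Y \ X) a) := by
  unfold compAt at hz ⊢
  split_ifs at hz ⊢ with h
  · exact ⟨rfl, h⟩
  · simp at hz

/-- A non-empty listed set is a connected cube set through its index (a member of D.1's family at `□ = a`).
[folklore] -/
theorem mem_and_isRConnected_of_mem_compAt (hR : ∀ x y, R x y → R y x) {A X Y : Finset V} {a z : V}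
    (hz : z ∈ compAt R A X Y a) : a ∈ compAt R A X Y a ∧ IsRConnected R (compAt R A X Y a) := by
  obtain ⟨hCeq, ha⟩ := compAt_eq_of_mem hz
  have haC := pick_subset A _ ha
  rw [mem_inter] at haC
  have haYX : a ∈ Y \ X := rcomponent_subset _ _ haC.1
  rw [hCeq]
  exact ⟨haC.1, isRConnected_rcomponent hR haYX⟩

/-- COVERING: under an anchor set, every cube of `Y − X` lies in the set listed at the chosen anchor of its component
(*"the sum can be written as a sum over the {W_α}"*). [cite: Dimock2013BalabanII, App. D proof of Lemma D.2 (arXiv:1212.5562v2 TeX L6744)] -/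
theorem exists_mem_compAt (hR : ∀ x y, R x y → R y x) {A X Y : Finset V} (hY : HasAnchors R A X Y) {y : V}
    (hy : y ∈ Y \ X) : ∃ a ∈ A, y ∈ compAt R A X Y a := by
  obtain ⟨a₁, ha₁C, ha₁A⟩ := hY y hy
  have hne : (rcomponent R (Y \ X) y ∩ A).Nonempty := ⟨a₁, mem_inter.2 ⟨ha₁C, ha₁A⟩⟩
  obtain ⟨a, ha⟩ := pick_nonempty hne
  have haCA := pick_subset A _ ha
  rw [mem_inter] at haCA
  have hCa : rcomponent R (Y \ X) a = rcomponent R (Y \ X) y := rcomponent_eq_of_mem hR haCA.1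
  refine ⟨a, haCA.2, ?_⟩
  unfold compAt
  rw [hCa, if_pos ha]
  exact mem_rcomponent_self hy

/-- The listed sets cover exactly `Y − X`. [cite: Dimock2013BalabanII, App. D proof of Lemma D.2 (arXiv:1212.5562v2 TeX L6742–6744)] -/
theorem biUnion_compAt (hR : ∀ x y, R x y → R y x) {A X Y : Finset V} (hY : HasAnchors R A X Y) :
    A.biUnion (compAt R A X Y) = Y \ X := by
  ext z
  rw [mem_biUnion]
  constructor
  · rintro ⟨a, -, hz⟩
    exact compAt_subset a hz
  · intro hz
    obtain ⟨a, ha, hz'⟩ := exists_mem_compAt hR hY hz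
    exact ⟨a, ha, hz'⟩

/-- The listed sets are pairwise disjoint (*"{W_α} … a collection of disjoint connected subsets"*: distinct indices
carrying non-empty sets carry distinct — hence disjoint — components). [cite: Dimock2013BalabanII, App. D proof of Lemma D.2 (arXiv:1212.5562v2 TeX L6741)] -/
theorem pairwiseDisjoint_compAt (hR : ∀ x y, R x y → R y x) (A X Y : Finset V) :
    (A : Set V).PairwiseDisjoint (compAt R A X Y) := by
  intro a _ a' _ hne
  change Disjoint (compAt R A X Y a) (compAt R A X Y a')
  rw [disjoint_left]
  intro z hz hz'
  obtain ⟨hCa, ha⟩ := compAt_eq_of_mem hz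
  obtain ⟨hCa', ha'⟩ := compAt_eq_of_mem hz'
  rw [hCa] at hz
  rw [hCa'] at hz'
  have h1 := rcomponent_eq_of_mem hR hz
  have h2 := rcomponent_eq_of_mem hR hz'
  have hCC : rcomponent R (Y \ X) a = rcomponent R (Y \ X) a' := h1.symm.trans h2
  rw [hCC] at ha
  exact hne (eq_of_mem_pick ha ha')

/-- `|Y − X|_Ω = Σ_α |W_α|_Ω`, the components listed once each. [cite: Dimock2013BalabanII, App. D proof of Lemma D.2 (arXiv:1212.5562v2 TeX L6752)] -/
theorem card_sdiff_eq_sum (hR : ∀ x y, R x y → R y x) {A X Y : Finset V} (hY : HasAnchors R A X Y) :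
    (Y \ X).card = ∑ a ∈ A, (compAt R A X Y a).card := by
  rw [← biUnion_compAt hR hY, card_biUnion (pairwiseDisjoint_compAt hR A X Y)]

/-- `λ^{|Y−X|_Ω} = Π_α λ^{|W_α|_Ω}` (*"e^{−κ_* Σ_α|W_α|_Ω}"* as a product over anchors, empty slots contributing `1`).
[cite: Dimock2013BalabanII, App. D proof of Lemma D.2 (arXiv:1212.5562v2 TeX L6752–6753)] -/
theorem pow_card_sdiff_eq_prod (hR : ∀ x y, R x y → R y x) {A X Y : Finset V} (hY : HasAnchors R A X Y)
    (lam : ℝ) : lam ^ (Y \ X).card = ∏ a ∈ A, lam ^ (compAt R A X Y a).card := by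
  rw [card_sdiff_eq_sum hR hY, prod_pow_eq_pow_sum]

/-- INJECTIVITY (*"Y = X ∪ (∪_α W_α)"*): `Y ⊇ X` is recovered from its listed components. [cite: Dimock2013BalabanII, App. D proof of Lemma D.2 (arXiv:1212.5562v2 TeX L6742)] -/
theorem eq_of_compAt_eq (hR : ∀ x y, R x y → R y x) {A X Y Y' : Finset V} (hXY : X ⊆ Y)
    (hY : HasAnchors R A X Y) (hXY' : X ⊆ Y') (hY' : HasAnchors R A X Y')
    (h : ∀ a ∈ A, compAt R A X Y a = compAt R A X Y' a) : Y = Y' := by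
  have h1 : Y \ X = Y' \ X := by
    rw [← biUnion_compAt hR hY, ← biUnion_compAt hR hY']
    exact biUnion_congr rfl h
  rw [← union_sdiff_of_subset hXY, ← union_sdiff_of_subset hXY', h1]

/-- The map `Y ↦ {W_α}` as a function on the anchor set. [folklore] -/
def listing (R : V → V → Prop) (A X Y : Finset V) : A → Finset V := fun a => compAt R A X Y a

/-- `listing` at an anchor. [folklore] -/
@[simp] theorem listing_apply (A X Y : Finset V) (a : A) : listing R A X Y a = compAt R A X Y a := rfl

/-- The sets a given anchor `a` carries over a family `𝒴` (non-empty listed components), and the slots `{∅} ∪ those`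
— the index range *"Σ_{{□_α}} Π_α Σ_{W ⊃ □_α}"* of the domination step. [cite: Dimock2013BalabanII, App. D proof of Lemma D.2 (arXiv:1212.5562v2 TeX L6748–6753)] -/
def carried (R : V → V → Prop) (A X : Finset V) (𝒴 : Finset (Finset V)) (a : V) : Finset (Finset V) :=
  (𝒴.image fun Y => compAt R A X Y a).erase ∅

/-- The slots at an anchor: `∅` or a carried component. [folklore] -/
def slots (R : V → V → Prop) (A X : Finset V) (𝒴 : Finset (Finset V)) (a : V) : Finset (Finset V) :=
  insert ∅ (carried R A X 𝒴 a)

/-- Carried sets are connected cube sets through the anchor. [folklore] -/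
theorem mem_carried (hR : ∀ x y, R x y → R y x) {A X : Finset V} {𝒴 : Finset (Finset V)} {a : V}
    {C : Finset V} (hC : C ∈ carried R A X 𝒴 a) : a ∈ C ∧ IsRConnected R C := by
  unfold carried at hC
  obtain ⟨hC0, hC⟩ := mem_erase.1 hC
  obtain ⟨Y, -, hYC⟩ := mem_image.1 hC
  obtain ⟨z, hz⟩ := nonempty_iff_ne_empty.2 hC0
  rw [← hYC] at hz ⊢
  exact mem_and_isRConnected_of_mem_compAt hR hz

/-- Step 1 of the domination: each term is a product over the anchors. [folklore] -/
theorem pow_card_sdiff_eq_prod_listing (hR : ∀ x y, R x y → R y x) {A X Y : Finset V}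
    (hY : HasAnchors R A X Y) (lam : ℝ) :
    lam ^ (Y \ X).card = ∏ a : A, lam ^ (listing R A X Y a).card := by
  rw [pow_card_sdiff_eq_prod hR hY lam]
  simp only [listing_apply, univ_eq_attach]
  exact (prod_attach A (fun v => lam ^ (compAt R A X Y v).card)).symm

/-- Step 2: `Y ↦ {W_α}` is injective on the families of the primed sum. [folklore] -/
theorem listing_injOn (hR : ∀ x y, R x y → R y x) {A X : Finset V} {𝒴 : Finset (Finset V)}
    (h𝒴 : ∀ Y ∈ 𝒴, X ⊆ Y ∧ HasAnchors R A X Y) : Set.InjOn (listing R A X) 𝒴 := by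
  intro Y hY Y' hY' hFF
  exact eq_of_compAt_eq hR (h𝒴 Y hY).1 (h𝒴 Y hY).2 (h𝒴 Y' hY').1 (h𝒴 Y' hY').2
    (fun a ha => congrFun hFF ⟨a, ha⟩)

/-- Step 3: its range lies in the product of the slots. [folklore] -/
theorem listing_mem_piFinset {A X : Finset V} {𝒴 : Finset (Finset V)} {Y : Finset V} (hY : Y ∈ 𝒴) :
    listing R A X Y ∈ Fintype.piFinset (fun a : A => slots R A X 𝒴 a) := by
  rw [Fintype.mem_piFinset]
  intro a
  rw [listing_apply]
  unfold slots carried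
  rw [mem_insert]
  by_cases h : compAt R A X Y a = ∅
  · exact Or.inl h
  · exact Or.inr (mem_erase.2 ⟨h, mem_image.2 ⟨Y, hY, rfl⟩⟩)

/-- Step 4: the slot sum at one anchor, `1 + Σ_{W ∋ □} λ^{|W|} ≤ 1 + 2λ` by Lemma D.1 in the tree's form
(`sum_pow_card_le_of_connected`). [cite: Dimock2013BalabanII, App. D proof of Lemma D.2 (arXiv:1212.5562v2 TeX L6749–6754)] -/
theorem sum_slots_le (hR : ∀ x y, R x y → R y x) {nbr : V → Finset V} {Δ : ℕ}
    (hΔ : ∀ x, (nbr x).card ≤ Δ) (hnbr : ∀ x y, R x y → y ∈ nbr x) {lam : ℝ} (hlam : 0 ≤ lam)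
    (hsmall : ((Δ : ℝ) + 1) ^ 2 * lam ≤ 1 / 2) {A X : Finset V} {𝒴 : Finset (Finset V)} (a : A) :
    ∑ C ∈ slots R A X 𝒴 a, lam ^ C.card ≤ 1 + 2 * lam := by
  have hS : ∑ C ∈ carried R A X 𝒴 a, lam ^ C.card ≤ 2 * lam :=
    sum_pow_card_le_of_connected hR hΔ hnbr hlam hsmall (a : V) _ fun C hC => mem_carried hR hC
  have h0 : (∅ : Finset V) ∉ carried R A X 𝒴 a := by
    unfold carried
    exact notMem_erase _ _
  unfold slots
  rw [sum_insert h0, card_empty, pow_zero]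
  linarith

/-- **SECOND HALF OF THE PROOF OF LEMMA D.2, master form** — [Dimock2013BalabanII] App. D, verbatim: *"We enlarge the
sum to a sum over collections {□_α} of disjoint cubes in X′−X or even X′, and connected W_α so W_α ⊃ □_α. Using also
the previous lemma the sum is dominated by Σ_{{□_α}} Σ_{{W_α : W_α ⊃ □_α}} e^{−κ_* Σ_α|W_α|_Ω} = Σ_{{□_α}} Π_α Σ_{W ⊃
□_α} e^{−κ_*|W|_Ω} ≤ Σ_{{□_α}} Π_α e^{−½κ_*} = (1 + e^{−½κ_*})^{|X′|_Ω}"* — PROVED for every anchor set `A` met by all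
components of every `Y − X`, with D.1 in the tree's form `Σ_{W ∋ □} λ^{|W|} ≤ 2λ` (`sum_pow_card_le_of_connected`,
`0 ≤ λ`, `(Δ+1)²λ ≤ ½`): **Σ_{Y ∈ 𝒴} λ^{|Y − X|} ≤ (1 + 2λ)^{#A}**.  The Remark (999) is this statement with the
smaller anchor set. [cite: Dimock2013BalabanII, App. D Lemma D.2 and eq. (999) (arXiv:1212.5562v2 TeX L6748–6769)] -/
theorem sum_pow_card_sdiff_le (hR : ∀ x y, R x y → R y x) {nbr : V → Finset V} {Δ : ℕ}
    (hΔ : ∀ x, (nbr x).card ≤ Δ) (hnbr : ∀ x y, R x y → y ∈ nbr x) {lam : ℝ} (hlam : 0 ≤ lam)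
    (hsmall : ((Δ : ℝ) + 1) ^ 2 * lam ≤ 1 / 2) (A X : Finset V) (𝒴 : Finset (Finset V))
    (h𝒴 : ∀ Y ∈ 𝒴, X ⊆ Y ∧ HasAnchors R A X Y) :
    ∑ Y ∈ 𝒴, lam ^ (Y \ X).card ≤ (1 + 2 * lam) ^ A.card := by
  classical
  calc ∑ Y ∈ 𝒴, lam ^ (Y \ X).card
      = ∑ Y ∈ 𝒴, ∏ a : A, lam ^ (listing R A X Y a).card :=
        sum_congr rfl fun Y hY => pow_card_sdiff_eq_prod_listing hR (h𝒴 Y hY).2 lam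
    _ = ∑ f ∈ 𝒴.image (listing R A X), ∏ a : A, lam ^ (f a).card := by
        rw [sum_image (listing_injOn hR h𝒴)]
    _ ≤ ∑ f ∈ Fintype.piFinset (fun a : A => slots R A X 𝒴 a), ∏ a : A, lam ^ (f a).card := by
        refine sum_le_sum_of_subset_of_nonneg ?_ fun f _ _ => prod_nonneg fun a _ => pow_nonneg hlam _
        intro f hf
        obtain ⟨Y, hY, rfl⟩ := mem_image.1 hf
        exact listing_mem_piFinset hY
    _ = ∏ a : A, ∑ C ∈ slots R A X 𝒴 a, lam ^ C.card :=
        (prod_univ_sum (fun a : A => slots R A X 𝒴 a) fun _ C => lam ^ C.card).symm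
    _ ≤ ∏ _a : A, (1 + 2 * lam) :=
        prod_le_prod (fun a _ => sum_nonneg fun C _ => pow_nonneg hlam _)
          fun a _ => sum_slots_le hR hΔ hnbr hlam hsmall a
    _ = (1 + 2 * lam) ^ A.card := by rw [prod_const, card_univ, Fintype.card_coe]

/-- Master form, exponential shape: **Σ_{Y ∈ 𝒴} λ^{|Y − X|} ≤ exp(2λ·#A)**. [cite: Dimock2013BalabanII, App. D Lemma D.2 and eq. (999) (arXiv:1212.5562v2 TeX L6748–6769)] -/
theorem sum_pow_card_sdiff_le_exp (hR : ∀ x y, R x y → R y x) {nbr : V → Finset V} {Δ : ℕ}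
    (hΔ : ∀ x, (nbr x).card ≤ Δ) (hnbr : ∀ x y, R x y → y ∈ nbr x) {lam : ℝ} (hlam : 0 ≤ lam)
    (hsmall : ((Δ : ℝ) + 1) ^ 2 * lam ≤ 1 / 2) (A X : Finset V) (𝒴 : Finset (Finset V))
    (h𝒴 : ∀ Y ∈ 𝒴, X ⊆ Y ∧ HasAnchors R A X Y) :
    ∑ Y ∈ 𝒴, lam ^ (Y \ X).card ≤ Real.exp (2 * lam * A.card) :=
  (sum_pow_card_sdiff_le hR hΔ hnbr hlam hsmall A X 𝒴 h𝒴).trans (one_add_pow_le_exp (by linarith) _)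

/-- D.2 under the PRIMED CONDITION with anchors in `X′ − X`: **Σ′_{Y ⊇ X} λ^{|Y − X|} ≤ (1 + 2λ)^{Δ·#X}**.
[cite: Dimock2013BalabanII, App. D Lemma D.2 (arXiv:1212.5562v2 TeX L6727–6759)] -/
theorem sum_pow_card_sdiff_le_of_anchored (hR : ∀ x y, R x y → R y x) {nbr : V → Finset V} {Δ : ℕ}
    (hΔ : ∀ x, (nbr x).card ≤ Δ) (hnbr : ∀ x y, R x y → y ∈ nbr x) {lam : ℝ} (hlam : 0 ≤ lam)
    (hsmall : ((Δ : ℝ) + 1) ^ 2 * lam ≤ 1 / 2) (X : Finset V) (𝒴 : Finset (Finset V))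
    (h𝒴 : ∀ Y ∈ 𝒴, Anchored R X Y) :
    ∑ Y ∈ 𝒴, lam ^ (Y \ X).card ≤ (1 + 2 * lam) ^ (Δ * X.card) := by
  have h := sum_pow_card_sdiff_le hR hΔ hnbr hlam hsmall (extBdry nbr X) X 𝒴 fun Y hY =>
    ⟨(h𝒴 Y hY).1, hasAnchors_extBdry hR hnbr (h𝒴 Y hY)⟩
  exact h.trans (pow_le_pow_right₀ (by linarith) (card_extBdry_le hΔ X))

/-! ## Part 3. LEMMA D.1 and LEMMA D.2 in the printed exponential form, under *"½κ_* ≥ 2 log(2dL^{d−1}) + log 2"* -/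

/-- The printed parameter clause (with the tree's `Δ + 1` for Dimock's `2dL^{d−1}`) gives `(Δ+1)² e^{−½κ} ≤ ½`.
[cite: Dimock2013BalabanII, App. D proof of Lemma D.1 (arXiv:1212.5562v2 TeX L6721)] -/
theorem smallness_of_kappa {Δ : ℕ} {κ : ℝ} (hκ : Real.log 2 + 2 * Real.log ((Δ : ℝ) + 1) ≤ κ / 2) :
    ((Δ : ℝ) + 1) ^ 2 * Real.exp (-(κ / 2)) ≤ 1 / 2 := by
  have hpos : (0 : ℝ) < (Δ : ℝ) + 1 := by positivity
  have hlog : 2 * Real.log ((Δ : ℝ) + 1) = Real.log (((Δ : ℝ) + 1) ^ 2) := by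
    rw [Real.log_pow]; norm_num
  have h1 : Real.exp (Real.log 2 + 2 * Real.log ((Δ : ℝ) + 1)) = 2 * ((Δ : ℝ) + 1) ^ 2 := by
    rw [hlog, Real.exp_add, Real.exp_log two_pos, Real.exp_log (pow_pos hpos 2)]
  have h2 : 2 * ((Δ : ℝ) + 1) ^ 2 ≤ Real.exp (κ / 2) := by
    rw [← h1]; exact Real.exp_le_exp.2 hκ
  have h3 : 0 < Real.exp (κ / 2) := Real.exp_pos _
  rw [Real.exp_neg, mul_inv_le_iff₀ h3]
  linarith

/-- Consequences of the clause: `κ ≥ 0`, `e^{−½κ} ≤ ½`, `(Δ+1)² e^{−κ} ≤ ½`, `2e^{−κ} ≤ e^{−½κ}`. [folklore] -/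
theorem kappa_consequences {Δ : ℕ} {κ : ℝ} (hκ : Real.log 2 + 2 * Real.log ((Δ : ℝ) + 1) ≤ κ / 2) :
    0 ≤ κ ∧ Real.exp (-(κ / 2)) ≤ 1 / 2 ∧ ((Δ : ℝ) + 1) ^ 2 * Real.exp (-κ) ≤ 1 / 2 ∧
      2 * Real.exp (-κ) ≤ Real.exp (-(κ / 2)) := by
  have hsm := smallness_of_kappa hκ
  have hl2 : 0 < Real.log 2 := Real.log_pos one_lt_two
  have hlΔ : 0 ≤ Real.log ((Δ : ℝ) + 1) := Real.log_nonneg (by linarith [(Nat.cast_nonneg Δ : (0:ℝ) ≤ Δ)])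
  have hκ0 : 0 ≤ κ := by linarith
  have hsq : (1 : ℝ) ≤ ((Δ : ℝ) + 1) ^ 2 := one_le_pow₀ (by linarith [(Nat.cast_nonneg Δ : (0:ℝ) ≤ Δ)])
  have hE : 0 < Real.exp (-(κ / 2)) := Real.exp_pos _
  have ha : Real.exp (-(κ / 2)) ≤ 1 / 2 :=
    (le_mul_of_one_le_left hE.le hsq).trans hsm
  have hmono : Real.exp (-κ) ≤ Real.exp (-(κ / 2)) := Real.exp_le_exp.2 (by linarith)
  have hb : ((Δ : ℝ) + 1) ^ 2 * Real.exp (-κ) ≤ 1 / 2 :=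
    (mul_le_mul_of_nonneg_left hmono (by positivity)).trans hsm
  have hsqE : Real.exp (-κ) = Real.exp (-(κ / 2)) * Real.exp (-(κ / 2)) := by
    rw [← Real.exp_add]; ring_nf
  have hc : 2 * Real.exp (-κ) ≤ Real.exp (-(κ / 2)) := by
    rw [hsqE]; nlinarith
  exact ⟨hκ0, ha, hb, hc⟩

/-- `e^{−κ n} = (e^{−κ})^n`. [folklore] -/
theorem exp_neg_mul_nat (κ : ℝ) (n : ℕ) : Real.exp (-κ * n) = (Real.exp (-κ)) ^ n := by
  rw [← Real.exp_nat_mul]; ring_nf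

/-- **LEMMA D.1 (lugnut1) = §3.1 (lugnut8)** — [Dimock2013BalabanII], verbatim: *"for any elementary cube □ ⊂ 𝒟_{k,Ω}
and κ_* large enough  Σ_{X ∈ 𝒟_{k,Ω}, X ⊃ □} e^{−κ_*|X|_Ω} ≤ e^{−½κ_*}"* — PROVED for every finite family `𝒳` of
connected cube sets through `□ = q` of a cube complex with at most `Δ` neighbours per cube, under `½κ ≥ 2 log(Δ+1) +
log 2` (the tree's lazy-walk count; Dimock: `½κ_* ≥ 2 log(2dL^{d−1}) + log 2`). [cite: Dimock2013BalabanII, App. D Lemma D.1 (arXiv:1212.5562v2 TeX L6699–6722) and §3.1 eq. (lugnut8) (TeX L1707–1717)] -/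
theorem donut1 (hR : ∀ x y, R x y → R y x) {nbr : V → Finset V} {Δ : ℕ} (hΔ : ∀ x, (nbr x).card ≤ Δ)
    (hnbr : ∀ x y, R x y → y ∈ nbr x) {κ : ℝ} (hκ : Real.log 2 + 2 * Real.log ((Δ : ℝ) + 1) ≤ κ / 2)
    (q : V) (𝒳 : Finset (Finset V)) (h𝒳 : ∀ X ∈ 𝒳, q ∈ X ∧ IsRConnected R X) :
    ∑ X ∈ 𝒳, Real.exp (-κ * X.card) ≤ Real.exp (-(κ / 2)) := by
  obtain ⟨-, -, hb, hc⟩ := kappa_consequences hκ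
  calc ∑ X ∈ 𝒳, Real.exp (-κ * X.card) = ∑ X ∈ 𝒳, (Real.exp (-κ)) ^ X.card :=
        sum_congr rfl fun X _ => exp_neg_mul_nat κ X.card
    _ ≤ 2 * Real.exp (-κ) := sum_pow_card_le_of_connected hR hΔ hnbr (Real.exp_pos _).le hb q 𝒳 h𝒳
    _ ≤ Real.exp (-(κ / 2)) := hc

/-- **LEMMA D.2 (lugnut2), anchor form = the Remark (999)** — for every anchor set `A` met by all components of every
`Y − X`: **Σ_{Y ∈ 𝒴} e^{−κ|Y − X|} ≤ exp(e^{−½κ}·#A)** (Dimock, (999): *"the anchors {□_α} in X′−X are M-cubes. Hence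
we get |X−X′|_M* ⟦sic: `|X′−X|_M`⟧ *≤ |X′|_M rather than the (possibly much larger) |X′|_Ω"* — the bound depends on the
anchors only through their number). [cite: Dimock2013BalabanII, App. D eq. (999) (arXiv:1212.5562v2 TeX L6763–6769)] -/
theorem donut2_anchors (hR : ∀ x y, R x y → R y x) {nbr : V → Finset V} {Δ : ℕ} (hΔ : ∀ x, (nbr x).card ≤ Δ)
    (hnbr : ∀ x y, R x y → y ∈ nbr x) {κ : ℝ} (hκ : Real.log 2 + 2 * Real.log ((Δ : ℝ) + 1) ≤ κ / 2)
    (A X : Finset V) (𝒴 : Finset (Finset V)) (h𝒴 : ∀ Y ∈ 𝒴, X ⊆ Y ∧ HasAnchors R A X Y) :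
    ∑ Y ∈ 𝒴, Real.exp (-κ * (Y \ X).card) ≤ Real.exp (Real.exp (-(κ / 2)) * A.card) := by
  obtain ⟨-, -, hb, hc⟩ := kappa_consequences hκ
  have hE : 0 ≤ Real.exp (-κ) := (Real.exp_pos _).le
  calc ∑ Y ∈ 𝒴, Real.exp (-κ * (Y \ X).card) = ∑ Y ∈ 𝒴, (Real.exp (-κ)) ^ (Y \ X).card :=
        sum_congr rfl fun Y _ => exp_neg_mul_nat κ (Y \ X).card
    _ ≤ (1 + 2 * Real.exp (-κ)) ^ A.card := sum_pow_card_sdiff_le hR hΔ hnbr hE hb A X 𝒴 h𝒴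
    _ ≤ (1 + Real.exp (-(κ / 2))) ^ A.card := pow_le_pow_left₀ (by positivity) (by linarith) _
    _ ≤ Real.exp (Real.exp (-(κ / 2)) * A.card) := one_add_pow_le_exp (Real.exp_pos _).le _

/-- **LEMMA D.2 (lugnut2), as printed** — [Dimock2013BalabanII], verbatim: *"With κ_* as above  Σ′_{Y ⊃ X}
e^{−κ_*|Y−X|_Ω} ≤ exp(e^{−½κ_*}(2dL^{d−1}+1)|X|_Ω)  where the primed sum means every connected component of Y contains
at least one connected component of X"* — PROVED for every finite family `𝒴` of cube sets `Y ⊇ X` satisfying the primed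
condition, in a cube complex with at most `Δ` neighbours per cube, under `½κ ≥ 2 log(Δ+1) + log 2`: **Σ_{Y ∈ 𝒴}
e^{−κ|Y − X|} ≤ exp(e^{−½κ}(Δ+1)|X|)**. [cite: Dimock2013BalabanII, App. D Lemma D.2 (arXiv:1212.5562v2 TeX L6727–6759)] -/
theorem donut2 (hR : ∀ x y, R x y → R y x) {nbr : V → Finset V} {Δ : ℕ} (hΔ : ∀ x, (nbr x).card ≤ Δ)
    (hnbr : ∀ x y, R x y → y ∈ nbr x) {κ : ℝ} (hκ : Real.log 2 + 2 * Real.log ((Δ : ℝ) + 1) ≤ κ / 2)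
    (X : Finset V) (𝒴 : Finset (Finset V)) (h𝒴 : ∀ Y ∈ 𝒴, Anchored R X Y) :
    ∑ Y ∈ 𝒴, Real.exp (-κ * (Y \ X).card) ≤ Real.exp (Real.exp (-(κ / 2)) * (((Δ : ℝ) + 1) * X.card)) := by
  have h := donut2_anchors hR hΔ hnbr hκ (X ∪ extBdry nbr X) X 𝒴 fun Y hY =>
    ⟨(h𝒴 Y hY).1, hasAnchors_union_extBdry hR hnbr (h𝒴 Y hY)⟩
  refine h.trans (Real.exp_le_exp.2 (mul_le_mul_of_nonneg_left ?_ (Real.exp_pos _).le))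
  exact_mod_cast card_union_extBdry_le hΔ X

/-- The sharper exponent with anchors in `X′ − X` only: **Σ′ ≤ exp(e^{−½κ}·Δ·|X|)**. [cite: Dimock2013BalabanII, App. D Lemma D.2 (arXiv:1212.5562v2 TeX L6748)] -/
theorem donut2_sharp (hR : ∀ x y, R x y → R y x) {nbr : V → Finset V} {Δ : ℕ} (hΔ : ∀ x, (nbr x).card ≤ Δ)
    (hnbr : ∀ x y, R x y → y ∈ nbr x) {κ : ℝ} (hκ : Real.log 2 + 2 * Real.log ((Δ : ℝ) + 1) ≤ κ / 2)
    (X : Finset V) (𝒴 : Finset (Finset V)) (h𝒴 : ∀ Y ∈ 𝒴, Anchored R X Y) :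
    ∑ Y ∈ 𝒴, Real.exp (-κ * (Y \ X).card) ≤ Real.exp (Real.exp (-(κ / 2)) * ((Δ : ℝ) * X.card)) := by
  have h := donut2_anchors hR hΔ hnbr hκ (extBdry nbr X) X 𝒴 fun Y hY =>
    ⟨(h𝒴 Y hY).1, hasAnchors_extBdry hR hnbr (h𝒴 Y hY)⟩
  refine h.trans (Real.exp_le_exp.2 (mul_le_mul_of_nonneg_left ?_ (Real.exp_pos _).le))
  exact_mod_cast card_extBdry_le hΔ X

/-- The connected case of L4705: for `X ≠ ∅` and a family of CONNECTED `Y ⊇ X`, **Σ_{Y ∈ 𝒴} e^{−κ|Y − X|} ≤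
exp(e^{−½κ}(Δ+1)|X|)** with no primed condition to check. [cite: Dimock2013BalabanII, §3.13 (arXiv:1212.5562v2 TeX L4703–4707)] -/
theorem donut2_connected (hR : ∀ x y, R x y → R y x) {nbr : V → Finset V} {Δ : ℕ} (hΔ : ∀ x, (nbr x).card ≤ Δ)
    (hnbr : ∀ x y, R x y → y ∈ nbr x) {κ : ℝ} (hκ : Real.log 2 + 2 * Real.log ((Δ : ℝ) + 1) ≤ κ / 2)
    {X : Finset V} (hX : X.Nonempty) (𝒴 : Finset (Finset V)) (h𝒴 : ∀ Y ∈ 𝒴, X ⊆ Y ∧ IsRConnected R Y) :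
    ∑ Y ∈ 𝒴, Real.exp (-κ * (Y \ X).card) ≤ Real.exp (Real.exp (-(κ / 2)) * (((Δ : ℝ) + 1) * X.card)) :=
  donut2 hR hΔ hnbr hκ X 𝒴 fun Y hY => anchored_of_isRConnected (h𝒴 Y hY).1 hX (h𝒴 Y hY).2

end Abstract

/-! ## Part 4. On the cell's periodic polymer model `𝒟_k` (`M`-cubes of the torus `(ℤ/N)^d`, common walls, `Δ = 2d`) -/

section Torus

variable {d N : ℕ} [NeZero N]

omit [NeZero N] in
/-- Wall adjacency on the torus is symmetric (unit pv22). [folklore] -/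
theorem tadj_symm' : ∀ a b : TPt d N, TAdj a b → TAdj b a := fun _ _ h => h.symm

/-- `tnbr` lists the wall-neighbours (unit pv22). [folklore] -/
theorem mem_tnbr_of_tadj : ∀ a b : TPt d N, TAdj a b → b ∈ tnbr a := fun _ _ h => mem_tnbr.2 h

/-- *"Since each cube has at most 2d … neighbors"* on the torus: `#(tnbr a) ≤ 2d` (unit pv22's `tdegreeLE`).
[cite: Dimock2013BalabanII, App. D proof of Lemma D.1 (arXiv:1212.5562v2 TeX L6715)] -/
theorem card_tnbr_le (a : TPt d N) : (tnbr a).card ≤ 2 * d := tdegreeLE d N a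

/-- The primed condition on the torus in the cell's chain vocabulary (`TLinked Y y x`: a chain of cubes of `Y` with
common walls from `y` to `x`). [cite: Dimock2013BalabanII, App. D Lemma D.2 (arXiv:1212.5562v2 TeX L6731)] -/
def TAnchored (X Y : Finset (TPt d N)) : Prop := X ⊆ Y ∧ ∀ y ∈ Y, ∃ x ∈ X, TLinked Y y x

omit [NeZero N] in
/-- `TAnchored` is `Anchored TAdj`. [folklore] -/
theorem anchored_of_tAnchored {X Y : Finset (TPt d N)} (h : TAnchored X Y) : Anchored TAdj X Y := by
  refine ⟨h.1, fun y hy => ?_⟩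
  obtain ⟨x, hx, hyx⟩ := h.2 y hy
  refine ⟨x, hx, ?_⟩
  unfold TLinked at hyx
  exact Relation.ReflTransGen.mono (fun a b (hab : TStepIn Y a b) =>
    (⟨hab.2.2, hab.1, hab.2.1⟩ : TAdj a b ∧ a ∈ Y ∧ b ∈ Y)) _ _ hyx

/-- **LEMMA D.1 ON THE TORUS**, every dimension: for `½κ ≥ 2 log(2d+1) + log 2`, every cube `□` and every finite family
`𝒳` of torus localization domains through `□`, **Σ_{X ∈ 𝒳} e^{−κ|X|} ≤ e^{−½κ}**. [cite: Dimock2013BalabanII, App. D Lemma D.1 (arXiv:1212.5562v2 TeX L6699–6722)] -/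
theorem donut1_torus {κ : ℝ} (hκ : Real.log 2 + 2 * Real.log (2 * (d : ℝ) + 1) ≤ κ / 2) (c : TPt d N)
    (𝒳 : Finset (Finset (TPt d N))) (h𝒳 : ∀ X ∈ 𝒳, c ∈ X ∧ TFaceConnected X) :
    ∑ X ∈ 𝒳, Real.exp (-κ * X.card) ≤ Real.exp (-(κ / 2)) := by
  have hκ' : Real.log 2 + 2 * Real.log (((2 * d : ℕ) : ℝ) + 1) ≤ κ / 2 := by push_cast; exact hκ
  exact donut1 tadj_symm' card_tnbr_le mem_tnbr_of_tadj hκ' c 𝒳 fun X hX =>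
    ⟨(h𝒳 X hX).1, isRConnected_of_tFaceConnected ⟨c, (h𝒳 X hX).1⟩ (h𝒳 X hX).2⟩

/-- **LEMMA D.2 ON THE TORUS**, every dimension: for `½κ ≥ 2 log(2d+1) + log 2`, every cube set `X` and every finite
family `𝒴` of cube sets `Y ⊇ X` satisfying the primed condition, **Σ_{Y ∈ 𝒴} e^{−κ|Y − X|} ≤ exp(e^{−½κ}(2d+1)|X|)**.
[cite: Dimock2013BalabanII, App. D Lemma D.2 (arXiv:1212.5562v2 TeX L6727–6759)] -/
theorem donut2_torus {κ : ℝ} (hκ : Real.log 2 + 2 * Real.log (2 * (d : ℝ) + 1) ≤ κ / 2) (X : Finset (TPt d N))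
    (𝒴 : Finset (Finset (TPt d N))) (h𝒴 : ∀ Y ∈ 𝒴, TAnchored X Y) :
    ∑ Y ∈ 𝒴, Real.exp (-κ * (Y \ X).card) ≤ Real.exp (Real.exp (-(κ / 2)) * ((2 * (d : ℝ) + 1) * X.card)) := by
  have hκ' : Real.log 2 + 2 * Real.log (((2 * d : ℕ) : ℝ) + 1) ≤ κ / 2 := by push_cast; exact hκ
  have h := donut2 tadj_symm' card_tnbr_le mem_tnbr_of_tadj hκ' X 𝒴 fun Y hY => anchored_of_tAnchored (h𝒴 Y hY)
  push_cast at h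
  exact h

/-- **LEMMA D.2 ON THE TORUS, connected case** (L4705): for `X ≠ ∅` and a finite family `𝒴` of torus localization
domains `Y ⊇ X`, **Σ_{Y ∈ 𝒴} e^{−κ|Y − X|} ≤ exp(e^{−½κ}(2d+1)|X|)**. [cite: Dimock2013BalabanII, §3.13 (arXiv:1212.5562v2 TeX L4703–4707)] -/
theorem donut2_torus_connected {κ : ℝ} (hκ : Real.log 2 + 2 * Real.log (2 * (d : ℝ) + 1) ≤ κ / 2)
    {X : Finset (TPt d N)} (hX : X.Nonempty) (𝒴 : Finset (Finset (TPt d N)))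
    (h𝒴 : ∀ Y ∈ 𝒴, X ⊆ Y ∧ TFaceConnected Y) :
    ∑ Y ∈ 𝒴, Real.exp (-κ * (Y \ X).card) ≤ Real.exp (Real.exp (-(κ / 2)) * ((2 * (d : ℝ) + 1) * X.card)) := by
  have hκ' : Real.log 2 + 2 * Real.log (((2 * d : ℕ) : ℝ) + 1) ≤ κ / 2 := by push_cast; exact hκ
  have h := donut2_connected tadj_symm' card_tnbr_le mem_tnbr_of_tadj hκ' hX 𝒴 fun Y hY =>
    ⟨(h𝒴 Y hY).1, isRConnected_of_tFaceConnected (hX.mono (h𝒴 Y hY).1) (h𝒴 Y hY).2⟩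
  push_cast at h
  exact h

end Torus

end Literature.MathematicalPhysics.QuantumFieldTheory.Dimock2011to13.ConnectedPolymerSums
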